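/-
Copyright (c) 2026 the pub-hodgecm-mathlib formalisation cell (harness21).  Prover seat hodgecm-mathlib-K2Liu-p05 (g9) (chair VALVE 29 (jj) hand on the S6 table, S4 second box
retained), R90-TF section S6 «Ch. 14» (base R90-C14), h413 = `stmt-HodgeConjecture-24833`; card «FIN» of the S6 dealer R90-C14-plan, part FIN-3b (dealer (g3) RULINGS #1 (R2),
R90 bus 2026-09-05T03:36:32Z): the transport of ★ `R90S6EllipticFixFiniteLocal` to the one-place model `U(σ_w, Φ₃)(L_w)`.
-/
import Summits.HodgeConjecture.HodgeConjecture.Theorems.R90S6EllipticFixFiniteLocal    -- ★ FIN-3-LOCAL (this seat): `finite_fixedBy_quotient_gqs_of_isCompact_centralizer`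
import Literature.NumberTheory.Rogawski1990.TypeThreeCubicTorusNonsplit                   -- ★ `isRegularElt_iff_separable_localNonsplitEquiv` (regularity read in the one-place model); brings ★ `localNonsplitEquiv`
import Literature.NumberTheory.Automorphic.HermitianLatticeTreeEulerRelationCongr         -- ★ `finite_fixedBy_quotient_congr` (fixed cosets transport along `≃*` with `g ∈ C ↔ e g ∈ K`)
import HarnessLib

/-!
# R90-TF · S6 — «FIN-3b» `R90S6EllipticFixFiniteTransport`: the finiteness of fixed cosets, transported from `Gqs L v = U(Φ₃)(L⁺_v)` to the one-place model `U(σ_w, Φ₃)(L_w)`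
# (Kottwitz 1986 §3; Rogawski 1990 §4.9 p. 54, §3.1 p. 19)

Cell `hodgecm-mathlib`, crux H413 = `stmt-HodgeConjecture-24833`, route of record `HCCMUnconditional`; R90-TF section S6 (base `R90-C14`), dealer R90-C14-plan (g3), hand
K2Liu-p05 (g9).  ★ FIN-3-LOCAL proves: a regular element of `Gqs L v` with compact centraliser has finitely many fixed points on `Gqs L v ⧸ K` for every compact open `K`.  The (E1)∕(E2)
RECORD heads of the S6 elliptic identities state their finiteness letters `hfin₀ᵢ hfin₁ᵢ` for `unitaryGroupOfForm σ ((StdForm.antidiagonal 3).over K)` over an ABSTRACT valued field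
`K`; the G5 assembler reads them at `K := L_w` (`w ∣ v` the non-split place), `σ := σ_w`, where that group is the ONE-PLACE MODEL `U(σ_w, Φ₃)(L_w)` of `Gqs L v` through the
topological isomorphism ★ `localNonsplitEquiv` (`e : Gqs L v ≃ₜ* U(σ_w, placeForm Φ₃ w)`).  THIS FILE transports the finiteness through `e`, so that G5 discharges `hfin₀ᵢ hfin₁ᵢ` for
BOTH type-(2) classes (and the type-(1) literals) ONCE PER PLACE from three per-place facts it owns anyway: regularity (separable characteristic polynomial), compact centraliser
(anisotropic torus: ★ `compactSpace_centralizer_cmDatum_local_of_nodup_roots` ∕ ★ `UnitaryThreeAnisotropicStabilizerCompact`), and `K₀`, `K₁` compact open.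
* **`finite_fixedBy_quotient_onePlace_of_isCompact_centralizer`** — for `γ′ ∈ U(σ_w, placeForm Φ₃ w)` with separable characteristic polynomial and compact centraliser, and
  any compact open `K′`: `(fixedBy (U_w ⧸ K′) γ′).Finite`.  Proof: `γ := e⁻¹ γ′` is regular (★ `isRegularElt_iff_separable_localNonsplitEquiv`), `Z(γ) = e⁻¹(Z(γ′))` is compact
  (`Z(γ) = e⁻¹ Z(γ′)` as sets, `e` a homeomorphism), `C := e⁻¹(K′)` is compact open (`e` a homeomorphism), ★ FIN-3-LOCAL gives `Fix_γ(Gqs L v ⧸ C)` finite, and ★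
  `finite_fixedBy_quotient_congr` carries it to `Fix_{γ′}(U_w ⧸ K′)` (`g ∈ C ↔ e g ∈ K′` by definition of the preimage).
* `CompactSpace` spelling (`…_of_compactSpace_centralizer`).  (The set-builder spelling `{q | γ′ • q = q}` is `MulAction.fixedBy` by `Iff.rfl`; not restated — the
  `MulAction` instance search on the one-place carrier is slow.)
NOT HERE: the identification `placeForm Φ₃ w = (StdForm.antidiagonal 3).over L_w` of the form letter (★ `antidiagOne_eq_over` ∘ `StdForm.over_map`, a `rw` at G5) and the
compact-openness of `K₀ = GL₃(𝒪_w) ∩ U_w`, `K₁` (per-place standard facts; G5's frame).  THEOREMS ONLY (no `def`, no `instance`, no notation, no named-fact hypothesis, no `sorry`;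
default heartbeats); ★-only imports; lane `--supports stmt-HodgeConjecture-24833 --as helper`.

HONEST LABEL: HC_CM is proved only modulo the 7 printed citations (2 remaining named inputs: hLiu418 = `stmt-HodgeConjecture-24832`, h413 = `stmt-HodgeConjecture-24833`) until
rung 0 closes; finiteness letters are count-neutral plumbing of (E1)∕(E2); nothing here closes a socket; REL ≠ ★ ≠ BUILT.

## References
* [Kottwitz1986BaseChangeUnits] R. E. Kottwitz, *Base change for unit elements of Hecke algebras*, Compositio Math. 60 (1986), §3.
* [Rogawski1990] J. D. Rogawski, *Automorphic Representations of Unitary Groups in Three Variables*, Ann. of Math. Stud. 123 (1990), §4.9 p. 54, §3.1 p. 19.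
* [Laumon1995] G. Laumon, *Cohomology of Drinfeld Modular Varieties*, Part I (1996), Lemma (5.3.2) p. 136.
-/

set_option autoImplicit false
-- the mandated namespace repeats the single-problem summit's segment (`HodgeConjecture.HodgeConjecture`)
set_option linter.dupNamespace false

open NumberField IsDedekindDomain
open scoped Matrix MatrixGroups
open Literature.NumberTheory.Automorphic Literature.NumberTheory.Automorphic.UnitaryGroup Literature.NumberTheory.Rogawski1990
open Literature.NumberTheory.Rogawski1990.TypeThreeTorus (isRegularElt_iff_separable_localNonsplitEquiv)
open Literature.NumberTheory.Automorphic.HermitianLatticeTree (finite_fixedBy_quotient_congr)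

namespace Summit.HodgeConjecture.HodgeConjecture.R90.S6

section OnePlace

variable (L : Type) [Field L] [NumberField L] [IsCMField L] {v : HeightOneSpectrum (𝓞 ↥(maximalRealSubfield L))}

/-- **FIXED COSETS ARE FINITE IN THE ONE-PLACE MODEL.**  Let `w ∣ v` be a place of the CM field `L` fixed by the conjugation (`v` non-split), `U_w = U(σ_w, placeForm Φ₃ w)(L_w)`
the one-place model of `Gqs L v` (★ `localNonsplitEquiv`), `γ′ ∈ U_w` with SEPARABLE characteristic polynomial and COMPACT centraliser, `K′ ≤ U_w` compact open.  Then `γ′` has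
finitely many fixed points on `U_w ⧸ K′` — ★ `finite_fixedBy_quotient_gqs_of_isCompact_centralizer` at `γ := e⁻¹ γ′`, `C := e⁻¹ K′`, transported back along `e` by ★
`finite_fixedBy_quotient_congr`. [cite: Kottwitz1986BaseChangeUnits, §3] [cite: Rogawski1990, §4.9 p. 54; §3.1 p. 19] [cite: Laumon1995, Lemma (5.3.2) p. 136] -/
theorem finite_fixedBy_quotient_onePlace_of_isCompact_centralizer (w : PlacesOver L v) (hw : IsCMField.complexConj L • w.1 = w.1)
    (γ' : ↥(unitaryGroupOfForm (galAdicCompletionMap (L := L) (IsCMField.complexConj L) hw) (placeForm (qsForm L) w.1)))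
    (hreg : ((γ' : GL (Fin 3) (w.1.adicCompletion L)) : Matrix (Fin 3) (Fin 3) (w.1.adicCompletion L)).charpoly.Separable)
    (hZ : IsCompact ((Subgroup.centralizer ({γ'} : Set ↥(unitaryGroupOfForm (galAdicCompletionMap (L := L) (IsCMField.complexConj L) hw) (placeForm (qsForm L) w.1))) :
      Subgroup ↥(unitaryGroupOfForm (galAdicCompletionMap (L := L) (IsCMField.complexConj L) hw) (placeForm (qsForm L) w.1))) :
      Set ↥(unitaryGroupOfForm (galAdicCompletionMap (L := L) (IsCMField.complexConj L) hw) (placeForm (qsForm L) w.1))))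
    (K' : Subgroup ↥(unitaryGroupOfForm (galAdicCompletionMap (L := L) (IsCMField.complexConj L) hw) (placeForm (qsForm L) w.1)))
    (hK' : IsOpen (K' : Set ↥(unitaryGroupOfForm (galAdicCompletionMap (L := L) (IsCMField.complexConj L) hw) (placeForm (qsForm L) w.1))))
    (hK'c : IsCompact (K' : Set ↥(unitaryGroupOfForm (galAdicCompletionMap (L := L) (IsCMField.complexConj L) hw) (placeForm (qsForm L) w.1)))) :
    (MulAction.fixedBy (↥(unitaryGroupOfForm (galAdicCompletionMap (L := L) (IsCMField.complexConj L) hw) (placeForm (qsForm L) w.1)) ⧸ K') γ').Finite := by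
  -- the one-place model `e : Gqs L v ≃ₜ* U_w` and `γ := e⁻¹ γ′`
  let e := localNonsplitEquiv (IsCMField.complexConj L) (qsForm L) (IsCMField.complexConj_ne_one L) w hw
  obtain ⟨γ, rfl⟩ : ∃ γ : Gqs L v, e γ = γ' := ⟨e.symm γ', e.apply_symm_apply γ'⟩
  -- `γ` is regular
  have hreg' : IsRegularElt (γ.val : GL (Fin 3) (LocalRing L v)) := (isRegularElt_iff_separable_localNonsplitEquiv L w hw γ).2 hreg
  -- `Z(γ) = e⁻¹ Z(e γ)` is compact (`e` a homeomorphism; `g γ = γ g ↔ e g · e γ = e γ · e g`)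
  have hZγ : IsCompact ((Subgroup.centralizer ({γ} : Set (Gqs L v)) : Subgroup (Gqs L v)) : Set (Gqs L v)) := by
    have hpre : ((Subgroup.centralizer ({γ} : Set (Gqs L v)) : Subgroup (Gqs L v)) : Set (Gqs L v)) =
        e ⁻¹' ((Subgroup.centralizer ({e γ} : Set ↥(unitaryGroupOfForm (galAdicCompletionMap (L := L) (IsCMField.complexConj L) hw) (placeForm (qsForm L) w.1))) :
          Subgroup _) : Set _) := by
      refine Set.ext fun g => ⟨fun hg => ?_, fun hg => ?_⟩
      · have h := congrArg e (Subgroup.mem_centralizer_singleton_iff.1 hg)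
        exact Subgroup.mem_centralizer_singleton_iff.2 (by simpa only [map_mul] using h)
      · have h := Subgroup.mem_centralizer_singleton_iff.1 (show e g ∈ _ from hg)
        exact Subgroup.mem_centralizer_singleton_iff.2 (e.injective (((map_mul e g γ).trans h).trans (map_mul e γ g).symm))
    rw [hpre]
    exact e.toHomeomorph.isCompact_preimage.2 hZ
  -- `C := e⁻¹ K′` is compact open, with `g ∈ C ↔ e g ∈ K′`
  have hC : IsOpen ((K'.comap e.toMulEquiv.toMonoidHom : Subgroup (Gqs L v)) : Set (Gqs L v)) := hK'.preimage e.continuous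
  have hCc : IsCompact ((K'.comap e.toMulEquiv.toMonoidHom : Subgroup (Gqs L v)) : Set (Gqs L v)) :=
    e.toHomeomorph.isCompact_preimage.2 hK'c
  -- ★ FIN-3-LOCAL at `γ`, `C`; transport along `e`
  have hfin := finite_fixedBy_quotient_gqs_of_isCompact_centralizer hreg' hZγ (K'.comap e.toMulEquiv.toMonoidHom) hC hCc
  exact finite_fixedBy_quotient_congr (K'.comap e.toMulEquiv.toMonoidHom) K' e.toMulEquiv (fun _ => Iff.rfl) γ hfin

/-- The same with the centraliser's compactness as an instance `[CompactSpace ↥Z(γ′)]`. [cite: Kottwitz1986BaseChangeUnits, §3] [cite: Rogawski1990, §4.9 p. 54] -/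
theorem finite_fixedBy_quotient_onePlace_of_compactSpace_centralizer (w : PlacesOver L v) (hw : IsCMField.complexConj L • w.1 = w.1)
    (γ' : ↥(unitaryGroupOfForm (galAdicCompletionMap (L := L) (IsCMField.complexConj L) hw) (placeForm (qsForm L) w.1)))
    (hreg : ((γ' : GL (Fin 3) (w.1.adicCompletion L)) : Matrix (Fin 3) (Fin 3) (w.1.adicCompletion L)).charpoly.Separable)
    [hZ : CompactSpace ↥(Subgroup.centralizer ({γ'} : Set ↥(unitaryGroupOfForm (galAdicCompletionMap (L := L) (IsCMField.complexConj L) hw) (placeForm (qsForm L) w.1))))]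
    (K' : Subgroup ↥(unitaryGroupOfForm (galAdicCompletionMap (L := L) (IsCMField.complexConj L) hw) (placeForm (qsForm L) w.1)))
    (hK' : IsOpen (K' : Set ↥(unitaryGroupOfForm (galAdicCompletionMap (L := L) (IsCMField.complexConj L) hw) (placeForm (qsForm L) w.1))))
    (hK'c : IsCompact (K' : Set ↥(unitaryGroupOfForm (galAdicCompletionMap (L := L) (IsCMField.complexConj L) hw) (placeForm (qsForm L) w.1)))) :
    (MulAction.fixedBy (↥(unitaryGroupOfForm (galAdicCompletionMap (L := L) (IsCMField.complexConj L) hw) (placeForm (qsForm L) w.1)) ⧸ K') γ').Finite :=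
  finite_fixedBy_quotient_onePlace_of_isCompact_centralizer L w hw γ' hreg (isCompact_iff_compactSpace.2 hZ) K' hK' hK'c

end OnePlace

end Summit.HodgeConjecture.HodgeConjecture.R90.S6
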